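import Literature.NumberTheory.DiophantineGeometry.NamedHypothesesRHProofs
import Literature.NumberTheory.LFunctions.ZeroCounting
import Literature.Barriers.RiemannHypothesis.TuranPartialSumsInfinitude
import Literature.Barriers.RiemannHypothesis.TuranPartialSumsMontgomeryProofs
import Summits.RiemannHypothesis.Statement
import HarnessLib

/-!
# Truncation tails are height-blind: Bohr almost periodicity + Hurwitz (zd-neg g10 §3)

Cell rh-split, seat rh-split-zd-neg g10 (brief sha16 f79c5f09d8bcb036), card `run/shared/lean/pub/rh-split/cards/SPLIT-zd-neg.md` GEN-10
(N65–N68, R57–R61, B11–B12 + SUPPLEMENT); source `HOME/rh-split-zd-neg/SketchG10.lean` v2 sha16 29368ce59f30369a (namespace `RhSplitZdNegG10`),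
referee rh-split-ref-2 g0: GEN-10 REPLAY PASS on kernel v2 + CONTENT read-backs R1–R10 + LABELS N65–N68 UPHELD (2026-08-27T09:34:25Z, `INBOX.md`);
lead rh-split-lead g3; CARVE MAP + CUT.md in `HOME/rh-split-zd-neg/carve-g10/`.  Deltas vs the source (CUT.md): namespace ↦ `…Splittings.<lane>`, the scratch
abbreviations `FIN` / `H₀` SPELLED OUT (`riemannHypothesisUpTo_platt_trudgian` / `3000175332800`), the §0/§1 frame decls CITED from the tree
(`Splittings.ZdReferencePinsFrame`: `RHAbove`, `rh_of_fin_of_rhAbove`, `rhAbove_of_rh`, `two_le_count_jump`, `zetaArgS_sub`) instead of restated,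
`primesLE_mono` ↦ Mathlib `Nat.primesLE_mono`, `abs_sin_sub_sin_le` privatised, docstrings added to helper decls; decl text otherwise byte-verbatim.

CONTENT (zero side of the zd splitting search): every tail of the form «a FIXED Dirichlet polynomial (e.g. the section ζ_N) has no zeros in an open
strip / half-plane above height H» is EQUIVALENT to the same statement at H = 0 — truncation tails are HEIGHT-BLIND, so `riemannHypothesisUpTo_platt_trudgian`
is never load-bearing next to them (rows N65/N66: NOT A SPLITTING), and the Turán-type instance is refuted in the tree. LABELS (proposed): RH-FREE
kernel bookkeeping; class (zd, neg) UNCHANGED = BARRIER NOTE.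

This file: §3 `truncCoeff`, `dirichletPoly` (+ `zetaPartialSum_eq_dirichletPoly`), `exists_zero_im_gt_of_zero_mem_strip` (a zero of a Dirichlet polynomial in an
OPEN vertical strip recurs above every height), `stripZeroFreeAbove_iff`, `halfPlaneZeroFreeAbove_iff`, `sectionZeroFreeAbove_iff`, N65 `SectionTailAbove H`
with `sectionTailAbove_iff` (↔ `TuranHypothesis`, for EVERY `H`), `sectionTailAbove_iff_zero`, `not_sectionTailAbove` (Montgomery 1983, tree theorem,
standard axioms) and the vacuous `rh_of_fin_of_sectionTailAbove`. The certificate-based twins (`not_sectionTailAbove'`, `not_sectionZeroFreeAbove`) are in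
`ZdTruncationTailsCert.lean` (computational axioms, by design).

HONEST LABEL: «SPLITTING SEARCH over kernel-typed RH-EQUIVALENCES; a splitting A ∧ B ⟹ RH is CONDITIONAL bookkeeping unless A and B are
both proved; nothing here bears on the truth of RH.»
-/

set_option linter.dupNamespace false

noncomputable section

open Filter Complex Metric Set
open scoped Real Topology

namespace Summit.RiemannHypothesis.RiemannHypothesis.Theorems.Splittings.ZdTruncationTails

open Literature.NumberTheory.DiophantineGeometry Literature.NumberTheory.LFunctions
  Literature.Barriers.RiemannHypothesis MeasureTheory

/-! ## §3 Truncation tails are height-blind (Bohr almost periodicity + Hurwitz) -/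

/-- Truncated coefficients `a · 𝟙_{n ≤ N}`. -/
def truncCoeff (a : ℕ → ℂ) (N : ℕ) : ℕ → ℂ := fun n ↦ if n ≤ N then a n else 0

/-- The Dirichlet polynomial `D_{a,N}(s) = Σ_{1 ≤ n ≤ N} a(n) n^{−s}`, as an `LSeries`. -/
def dirichletPoly (a : ℕ → ℂ) (N : ℕ) : ℂ → ℂ := LSeries (truncCoeff a N)

/-- It is the finite sum `Σ_{n = 1}^{N} a(n) / n^s`. -/
theorem dirichletPoly_eq_sum (a : ℕ → ℂ) (N : ℕ) (s : ℂ) :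
    dirichletPoly a N s = ∑ n ∈ Finset.Icc 1 N, a n / (n : ℂ) ^ s := by
  rw [dirichletPoly, LSeries, tsum_eq_sum (s := Finset.Icc 1 N)]
  · refine Finset.sum_congr rfl fun n hn ↦ ?_
    rw [Finset.mem_Icc] at hn
    rw [LSeries.term_of_ne_zero (by omega), truncCoeff, if_pos hn.2]
  · intro n hn
    rw [Finset.mem_Icc, not_and_or, not_le, not_le] at hn
    rcases eq_or_ne n 0 with rfl | hn0
    · simp [LSeries.term]
    · rw [LSeries.term_of_ne_zero hn0, truncCoeff, if_neg (by omega), zero_div]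

/-- The sections of `ζ` are the case `a ≡ 1`. -/
theorem zetaPartialSum_eq_dirichletPoly (N : ℕ) : zetaPartialSum N = dirichletPoly (fun _ ↦ 1) N := by
  rw [zetaPartialSum_eq_LSeries]; rfl

/-- Finitely supported series converge absolutely everywhere: abscissa `⊥`. -/
theorem abscissaOfAbsConv_truncCoeff (a : ℕ → ℂ) (N : ℕ) :
    LSeries.abscissaOfAbsConv (truncCoeff a N) = ⊥ := by
  refine le_bot_iff.1 (LSeries.abscissaOfAbsConv_le_of_forall_lt_LSeriesSummable' fun y _ ↦ ?_)
  refine summable_of_ne_finset_zero (s := Finset.range (N + 1)) fun n hn ↦ ?_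
  rw [Finset.mem_range, not_lt] at hn
  rcases eq_or_ne n 0 with rfl | hn0
  · simp [LSeries.term]
  · rw [LSeries.term_of_ne_zero hn0, truncCoeff, if_neg (by omega), zero_div]

/-- Dirichlet polynomials are entire. -/
theorem differentiable_dirichletPoly (a : ℕ → ℂ) (N : ℕ) : Differentiable ℂ (dirichletPoly a N) := by
  intro s
  have hs : s ∈ {z : ℂ | LSeries.abscissaOfAbsConv (truncCoeff a N) < z.re} := by
    simp only [Set.mem_setOf_eq, abscissaOfAbsConv_truncCoeff]
    exact EReal.bot_lt_coe _
  exact (LSeries_differentiableOn _ s hs).differentiableAt ((isOpen_re_gt_EReal _).mem_nhds hs)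

/-- Bohr translation numbers (tree theorem `bohr_almost_periodic_holds`, Bohr 1922 Satz 1): on any
strip `α ≤ σ ≤ β` and for any `ε > 0` there are arbitrarily large `T` with
`|D(s) − D(s + iT)| < ε` throughout the strip. -/
theorem exists_shift_ge (a : ℕ → ℂ) (N : ℕ) {α β ε : ℝ} (hαβ : α < β) (hε : 0 < ε) (Y : ℝ) :
    ∃ T : ℝ, Y ≤ T ∧ ∀ s : ℂ, α ≤ s.re → s.re ≤ β →
      ‖dirichletPoly a N s - dirichletPoly a N (s + T * I)‖ < ε := by
  have hα : LSeries.abscissaOfAbsConv (truncCoeff a N) < α := by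
    rw [abscissaOfAbsConv_truncCoeff]; exact EReal.bot_lt_coe _
  obtain ⟨τ, -, -, ⟨δ, hδ, hgap⟩, -, hτ⟩ :=
    Literature.NumberTheory.LFunctions.bohr_almost_periodic_holds _ α β ε hα hαβ hε
  obtain ⟨k₀, hk₀⟩ := eventually_atTop.1 hgap
  have hind : ∀ j : ℕ, τ k₀ + δ * j ≤ τ (k₀ + j) := by
    intro j
    induction j with
    | zero => simp
    | succ j ih =>
      have := hk₀ (k₀ + j) (by omega)
      rw [show k₀ + (j + 1) = k₀ + j + 1 by omega]
      push_cast
      linarith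
  obtain ⟨j, hj⟩ := exists_nat_ge ((Y - τ k₀) / δ)
  have hk : Y ≤ τ (k₀ + j) := by
    refine le_trans ?_ (hind j)
    have := (div_le_iff₀ hδ).1 hj
    linarith
  exact ⟨τ (k₀ + j), hk, fun s h1 h2 ↦ hτ (k₀ + j) s h1 h2⟩

/-- **Zeros of a Dirichlet polynomial in an open strip recur above every height.** If
`D(s₀) = 0` with `σ₁ < Re s₀ < σ₂`, then for every `B` there is a zero `s` of `D` with
`σ₁ < Re s < σ₂` and `Im s > B`. (If `D ≡ 0` near `s₀` this is trivial; otherwise `s₀` is isolated,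
`D ≠ 0` on a small circle inside the strip, the Bohr translates `D(· + iT_m) → D` uniformly on the
disc with `T_m → ∞`, and Hurwitz's theorem yields zeros `s + iT_m`.) -/
theorem exists_zero_im_gt_of_zero_mem_strip (a : ℕ → ℂ) (N : ℕ) {σ₁ σ₂ : ℝ}
    (h : ∃ s : ℂ, σ₁ < s.re ∧ s.re < σ₂ ∧ dirichletPoly a N s = 0) (B : ℝ) :
    ∃ s : ℂ, σ₁ < s.re ∧ s.re < σ₂ ∧ dirichletPoly a N s = 0 ∧ B < s.im := by
  obtain ⟨s₀, hσ₁, hσ₂, hs₀0⟩ := h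
  set Z : ℂ → ℂ := dirichletPoly a N with hZ
  have hZd : Differentiable ℂ Z := differentiable_dirichletPoly a N
  rcases (hZd.analyticAt s₀).eventually_eq_zero_or_eventually_ne_zero with hloc | hiso
  · -- `Z ≡ 0`: every point of the vertical line through `s₀` is a zero
    have hall := (hZd.differentiableOn.analyticOnNhd isOpen_univ)
      |>.eqOn_zero_of_preconnected_of_eventuallyEq_zero isPreconnected_univ (mem_univ s₀) hloc
    refine ⟨s₀ + ((|B| + |s₀.im| + 1 : ℝ) : ℂ) * I, ?_, ?_, hall (mem_univ _), ?_⟩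
    · simp only [add_re, mul_re, ofReal_re, I_re, mul_zero, ofReal_im, I_im, mul_one, sub_self,
        add_zero]
      exact hσ₁
    · simp only [add_re, mul_re, ofReal_re, I_re, mul_zero, ofReal_im, I_im, mul_one, sub_self,
        add_zero]
      exact hσ₂
    · simp only [add_im, mul_im, ofReal_re, I_im, mul_one, ofReal_im, I_re, mul_zero, add_zero]
      linarith [le_abs_self B, neg_abs_le s₀.im]
  · obtain ⟨ρ, hρ, hρZ⟩ : ∃ ρ > 0, ∀ z : ℂ, 0 < dist z s₀ → dist z s₀ < ρ → Z z ≠ 0 := by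
      rw [eventually_nhdsWithin_iff, Metric.eventually_nhds_iff] at hiso
      obtain ⟨ρ, hρ, h⟩ := hiso
      exact ⟨ρ, hρ, fun z h0 hlt ↦ h hlt (dist_pos.1 h0)⟩
    -- a small disc about `s₀`, inside the strip, with `Z ≠ 0` on its boundary circle
    set r : ℝ := min (ρ / 2) (min ((s₀.re - σ₁) / 2) ((σ₂ - s₀.re) / 2)) with hr
    have hr0 : 0 < r := lt_min (half_pos hρ) (lt_min (by linarith) (by linarith))
    have hrρ : r < ρ := (min_le_left _ _).trans_lt (half_lt_self hρ)
    have hr1 : r < s₀.re - σ₁ :=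
      ((min_le_right _ _).trans (min_le_left _ _)).trans_lt (by linarith)
    have hr2 : r < σ₂ - s₀.re :=
      ((min_le_right _ _).trans (min_le_right _ _)).trans_lt (by linarith)
    have hsphere : ∀ z ∈ sphere s₀ r, Z z ≠ 0 := fun z hz ↦ by
      rw [mem_sphere] at hz
      exact hρZ z (by rw [hz]; exact hr0) (by rw [hz]; exact hrρ)
    -- Bohr shifts `T m ≥ Y`, `1/(m+1)`-good on the strip `|Re s − Re s₀| ≤ r`
    set Y : ℝ := |B| + |s₀.im| + r + 1 with hY
    have hT : ∀ m : ℕ, ∃ T : ℝ, Y ≤ T ∧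
        ∀ s : ℂ, s ∈ closedBall s₀ r → ‖Z s - Z (s + T * I)‖ < 1 / (m + 1) := by
      intro m
      obtain ⟨T, hTY, hT⟩ := exists_shift_ge a N (α := s₀.re - r) (β := s₀.re + r)
        (ε := 1 / (m + 1)) (by linarith) (by positivity) Y
      refine ⟨T, hTY, fun s hs ↦ hT s ?_ ?_⟩
      · rw [mem_closedBall, dist_eq_norm] at hs
        have := (abs_re_le_norm (s - s₀)).trans hs
        rw [sub_re] at this
        linarith [(abs_le.1 this).1]
      · rw [mem_closedBall, dist_eq_norm] at hs
        have := (abs_re_le_norm (s - s₀)).trans hs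
        rw [sub_re] at this
        linarith [(abs_le.1 this).2]
    choose T hTY hTb using hT
    -- the translates converge uniformly on the closed disc
    set g : ℕ → ℂ → ℂ := fun m s ↦ Z (s + T m * I) with hg
    have hunif : TendstoUniformlyOn g Z atTop (closedBall s₀ r) := by
      rw [Metric.tendstoUniformlyOn_iff]
      intro ε hε
      obtain ⟨M, hM⟩ := exists_nat_gt (1 / ε)
      filter_upwards [eventually_ge_atTop M] with m hm s hs
      have hm' : (1 : ℝ) / ε < m + 1 := hM.trans (by exact_mod_cast Nat.lt_succ_of_le hm)
      have hεm : 1 / ((m : ℝ) + 1) < ε := by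
        rw [div_lt_iff₀ hε] at hm'
        rw [div_lt_iff₀ (by positivity)]
        linarith
      calc dist (Z s) (g m s) = ‖Z s - Z (s + T m * I)‖ := dist_eq_norm _ _
        _ < 1 / ((m : ℝ) + 1) := hTb m s hs
        _ < ε := hεm
    have hdiff : ∀ᶠ m in atTop, DiffContOnCl ℂ (g m) (ball s₀ r) :=
      Eventually.of_forall fun m ↦
        (hZd.comp (differentiable_id.add (differentiable_const _))).diffContOnCl
    -- Hurwitz
    have hcont : ContinuousOn Z (sphere s₀ r) := hZd.continuous.continuousOn
    have hz := Complex.eventually_exists_zero_mem_ball_of_tendstoUniformlyOn hr0 hdiff hunif hcont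
      hs₀0 hsphere
    obtain ⟨m, s, hs, hgs⟩ := hz.exists
    have hs' : ‖s - s₀‖ < r := by rwa [mem_ball, dist_eq_norm] at hs
    have hre₁ : s₀.re - r ≤ s.re := by
      have := (abs_re_le_norm (s - s₀)).trans hs'.le
      rw [sub_re] at this
      linarith [(abs_le.1 this).1]
    have hre₂ : s.re ≤ s₀.re + r := by
      have := (abs_re_le_norm (s - s₀)).trans hs'.le
      rw [sub_re] at this
      linarith [(abs_le.1 this).2]
    have him : s₀.im - r ≤ s.im := by
      have := (abs_im_le_norm (s - s₀)).trans hs'.le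
      rw [sub_im] at this
      linarith [(abs_le.1 this).1]
    refine ⟨s + T m * I, ?_, ?_, hgs, ?_⟩
    · simp only [add_re, mul_re, ofReal_re, I_re, mul_zero, ofReal_im, I_im, mul_one, sub_self,
        add_zero]
      linarith
    · simp only [add_re, mul_re, ofReal_re, I_re, mul_zero, ofReal_im, I_im, mul_one, sub_self,
        add_zero]
      linarith
    · simp only [add_im, mul_im, ofReal_re, I_im, mul_one, ofReal_im, I_re, mul_zero, add_zero]
      have h1 : Y ≤ T m := hTY m
      rw [hY] at h1
      linarith [le_abs_self B, neg_abs_le s₀.im]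

/-- **Height-blindness, strip form.** For every Dirichlet polynomial and every open strip:
zero-free above height `H` ⟺ zero-free. -/
theorem stripZeroFreeAbove_iff (a : ℕ → ℂ) (N : ℕ) (σ₁ σ₂ H : ℝ) :
    (∀ s : ℂ, σ₁ < s.re → s.re < σ₂ → H < s.im → dirichletPoly a N s ≠ 0) ↔
      (∀ s : ℂ, σ₁ < s.re → s.re < σ₂ → dirichletPoly a N s ≠ 0) := by
  refine ⟨fun h s h₁ h₂ hs ↦ ?_, fun h s h₁ h₂ _ ↦ h s h₁ h₂⟩
  obtain ⟨s', h₁', h₂', hs', hB⟩ := exists_zero_im_gt_of_zero_mem_strip a N ⟨s, h₁, h₂, hs⟩ H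
  exact h s' h₁' h₂' hB hs'

/-- **Height-blindness, half-plane form.** -/
theorem halfPlaneZeroFreeAbove_iff (a : ℕ → ℂ) (N : ℕ) (σ₁ H : ℝ) :
    (∀ s : ℂ, σ₁ < s.re → H < s.im → dirichletPoly a N s ≠ 0) ↔
      (∀ s : ℂ, σ₁ < s.re → dirichletPoly a N s ≠ 0) := by
  refine ⟨fun h s h₁ hs ↦ ?_, fun h s h₁ _ ↦ h s h₁⟩
  obtain ⟨s', h₁', -, hs', hB⟩ :=
    exists_zero_im_gt_of_zero_mem_strip a N (σ₂ := s.re + 1) ⟨s, h₁, by linarith, hs⟩ H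
  exact h s' h₁' hB hs'

/-- The same for the sections `ζ_N` in `σ > 1`, straight from the tree's Bohr–Spira theorem
`exists_zero_im_gt_of_exists_zero`. -/
theorem sectionZeroFreeAbove_iff (N : ℕ) (H : ℝ) :
    (∀ s : ℂ, 1 < s.re → H < s.im → zetaPartialSum N s ≠ 0) ↔
      (∀ s : ℂ, 1 < s.re → zetaPartialSum N s ≠ 0) := by
  refine ⟨fun h s h1 hs ↦ ?_, fun h s h1 _ ↦ h s h1⟩
  obtain ⟨s', h1', hs', hB⟩ := exists_zero_im_gt_of_exists_zero ⟨s, h1, hs⟩ H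
  exact h s' h1' hB hs'

/-- The Turán-type TRUNCATION TAIL: from some `N₀` on, every section `ζ_N` is zero-free in the
half-strip `σ > 1`, `t > H`. -/
def SectionTailAbove (H : ℝ) : Prop :=
  ∃ N₀ : ℕ, ∀ N : ℕ, N₀ ≤ N → ∀ s : ℂ, 1 < s.re → H < s.im → zetaPartialSum N s ≠ 0

/-- **`riemannHypothesisUpTo_platt_trudgian` is decorative for truncation tails**: the tail above ANY height is Turán's plain
hypothesis. -/
theorem sectionTailAbove_iff (H : ℝ) : SectionTailAbove H ↔ TuranHypothesis := by
  rw [TuranHypothesis_iff]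
  exact exists_congr fun N₀ ↦ forall₂_congr fun N _ ↦ sectionZeroFreeAbove_iff N H

/-- In particular the height never matters. -/
theorem sectionTailAbove_iff_zero (H : ℝ) : SectionTailAbove H ↔ SectionTailAbove 0 :=
  (sectionTailAbove_iff H).trans (sectionTailAbove_iff 0).symm

/-- REFUTED for every `H` (Montgomery 1983, tree theorem `Montgomery1983_theorem_holds`; standard
axioms). -/
theorem not_sectionTailAbove (H : ℝ) : ¬ SectionTailAbove H := fun h ↦
  not_TuranHypothesis_of_montgomeryThm Montgomery1983_theorem_holds ((sectionTailAbove_iff H).1 h)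

/-- Hence the "splitting" `riemannHypothesisUpTo_platt_trudgian ∧ SectionTailAbove 3000175332800 → RH` holds only vacuously, exactly like
Turán's criterion itself (`Turan1948_criterion_of_TuranPartialSums`). -/
theorem rh_of_fin_of_sectionTailAbove : riemannHypothesisUpTo_platt_trudgian ∧ SectionTailAbove 3000175332800 → RiemannHypothesis :=
  fun h ↦ absurd h.2 (not_sectionTailAbove 3000175332800)

end Summit.RiemannHypothesis.RiemannHypothesis.Theorems.Splittings.ZdTruncationTails

end
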